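import Summits.AtomisticToContinuum.FouriersLaw.Theorems.BondHeatUncertaintyExtensiveSnapshotIrreversibilityNessDensityPointwise
import Literature.MathematicalPhysics.KineticTheory.LangevinChainLyapunov
import Literature.Topology.FourManifolds.CollarUniquenessBall
import HarnessLib

/-!
# Crux `ExtensiveSnapshotIrreversibility` (stmt-AtomisticToContinuum-9121), line `hellinger-logmean`:
stub S_H1 `stub_oddLogDensitySandwich` — helper file 2 (the compact half from `δ`-uniform equicontinuity)

Support lemma for the registered stub S_H1 of the lead's checked skeleton v3 of the line.  The assembly
`helper_oddSandwichOfTwoSided` (helper file 1, landed) reduces S_H1 to a `δ`-uniform two-sided Gibbs sandwich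
(`NessLogDensityTwoSided`, not in print) and to the LOCAL input

  (F_cont) `∀ R ε > 0, ∀ᶠ δ → 0 (δ ≠ 0), ∀ x, H(x) ≤ R → |log ρ_δ(x) − log ρ_δ(Θx)| ≤ ε`

(uniform smallness of the odd log-ratio of the NESS density `ρ_δ` of `μ_{N,T+δ/2,T−δ/2}` on energy sublevel
sets).  This file proves (F_cont) from the natural output of a `δ`-uniform local hypoelliptic estimate:

  (F_equi) `δ`-uniform equicontinuity of `(ρ_δ)` on every energy sublevel set,
  `∀ R ε > 0, ∃ r > 0, ∀ᶠ δ, ∀ x, H(x) ≤ R → ∀ y ∈ B(x, r), |ρ_δ(y) − ρ_δ(x)| ≤ ε`,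

for the pinned anharmonic chain `P = pinnedChain ω₂ lam β γ` (all parameters positive), along every steady-state
family (no uniqueness guard), `T > 0`, `N ≥ 1`:

* (reused) `Literature.Topology.FourManifolds.abs_log_sub_log_le'` — `|log a − log b| ≤ |a − b| / min a b`;
* `tendstoUniformlyOn_density_of_equicontinuous` — (F_equi) and the landed POINTWISE convergence
  `ρ_δ(x) → ρ_T(x) := e^{−H(x)/T}/Z_T` at every point of equicontinuity
  (`LogDensity.ness_density_tendsto_of_equicontinuous`) give UNIFORM convergence on `{H ≤ R}`
  (finite `r`-net of the compact sublevel set + uniform continuity of `ρ_T` on a ball: Arzelà–Ascoli glue);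
* `helper_oddSandwichLocalOfEquicontinuous` (registered helper) — (F_equi) ⟹ (F_cont): on `{H ≤ R}` the Gibbs
  density is bounded below by `m > 0` and is `Θ`-even, so `|log ρ_δ − log ρ_δ∘Θ| ≤ 4 sup_{H≤R}|ρ_δ − ρ_T| / m`
  eventually.

References: N. Cuneo, J.-P. Eckmann, M. Hairer, L. Rey-Bellet, EJP 23 (2018) no. 55, Thm 2.13 (setting);
recon memo `work/stubs/S_H1-recon.md`.
-/

noncomputable section

namespace Summit.AtomisticToContinuum.FouriersLaw.Theorems.ExtensiveSnapshotIrreversibility.HellingerLogMean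

open MeasureTheory Filter Topology Set Metric
open scoped ENNReal NNReal
open Literature.MathematicalPhysics.KineticTheory.HeatConduction
open Summit.AtomisticToContinuum.FouriersLaw.Theorems.ExtensiveSnapshotIrreversibility.ClausiusBudget

/-! ## 1. Uniform convergence on energy sublevel sets from `δ`-uniform equicontinuity -/

/-- **Uniform convergence of the NESS densities on energy sublevel sets** from `δ`-uniform equicontinuity.
Along every steady-state family of the pinned chain (all parameters `> 0`), `T > 0`, `N ≥ 1`, for a density
family `ρ` (measurable, positive, representing `μ_{N,T+δ/2,T−δ/2}` eventually in `δ ≠ 0`) that is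
`δ`-uniformly equicontinuous on every sublevel set `{H ≤ R}`: for every `R` and `ε > 0`, eventually in `δ ≠ 0`,
`|ρ_δ(x) − e^{−H(x)/T}/Z_T| ≤ ε` for all `x` with `H(x) ≤ R`.  Finite `r`-net of the compact sublevel set, the
landed pointwise limit at the net points, equicontinuity of `ρ_δ` and uniform continuity of the Gibbs density on
a large ball. [folklore] -/
theorem tendstoUniformlyOn_density_of_equicontinuous {ω₂ lam β γ : ℝ} (hω : 0 < ω₂) (hl : 0 < lam)
    (hβ : 0 < β) (hγ : 0 < γ) {μ : (N : ℕ) → ℝ → ℝ → Measure (PhaseSpace N)}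
    (hμ : ∀ (N : ℕ) (T_L T_R : ℝ), 0 < T_L → 0 < T_R →
      (pinnedChain ω₂ lam β γ).IsSteadyState N T_L T_R (μ N T_L T_R))
    {T : ℝ} (hT : 0 < T) {N : ℕ} (hN : 0 < N) {ρ : ℝ → PhaseSpace N → ℝ}
    (hρm : ∀ δ, Measurable (ρ δ)) (hρpos : ∀ δ x, 0 < ρ δ x)
    (hρμ : ∀ᶠ δ in 𝓝[≠] (0 : ℝ), μ N (T + δ / 2) (T - δ / 2) =
      (volume : Measure (PhaseSpace N)).withDensity (fun x => ENNReal.ofReal (ρ δ x)))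
    (hequi : ∀ R ε : ℝ, 0 < ε → ∃ r : ℝ, 0 < r ∧ ∀ᶠ δ in 𝓝[≠] (0 : ℝ), ∀ x : PhaseSpace N,
      (pinnedChain ω₂ lam β γ).hamiltonian N x ≤ R → ∀ y ∈ Metric.ball x r, |ρ δ y - ρ δ x| ≤ ε)
    (R ε : ℝ) (hε : 0 < ε) :
    ∀ᶠ δ in 𝓝[≠] (0 : ℝ), ∀ x : PhaseSpace N, (pinnedChain ω₂ lam β γ).hamiltonian N x ≤ R →
      |ρ δ x - (pinnedChain ω₂ lam β γ).gibbsDensity N T x /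
        ∫ y, (pinnedChain ω₂ lam β γ).gibbsDensity N T y| ≤ ε := by
  set P := pinnedChain ω₂ lam β γ with hP
  set K : Set (PhaseSpace N) := {x | P.hamiltonian N x ≤ R} with hK
  have hKc : IsCompact K := pinnedChain_isCompact_setOf_hamiltonian_le hω hl.le hβ.le γ N R
  -- the Gibbs density at the mean temperature: continuous
  set Z : ℝ := ∫ y, P.gibbsDensity N T y with hZ
  set ρT : PhaseSpace N → ℝ := fun y => P.gibbsDensity N T y / Z with hρT
  have hρTc : Continuous ρT := (pinnedChain_continuous_gibbsDensity ω₂ lam β γ N T).div_const _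
  -- pointwise convergence at EVERY point (equicontinuity at `x` from the sublevel set `{H ≤ H x}`)
  have hpt : ∀ x : PhaseSpace N, Tendsto (fun δ : ℝ => ρ δ x) (𝓝[≠] (0 : ℝ)) (𝓝 (ρT x)) := by
    intro x
    refine LogDensity.ness_density_tendsto_of_equicontinuous ω₂ lam β γ hω hl hβ hγ μ hμ T hT N hN ρ hρm
      (fun δ y => (hρpos δ y).le) hρμ x fun ε' hε' => ?_
    obtain ⟨r, hr, hev⟩ := hequi (P.hamiltonian N x) ε' hε'
    exact ⟨r, hr, hev.mono fun δ hδ y hy => hδ x le_rfl y hy⟩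
  have hε3 : 0 < ε / 3 := by positivity
  -- (a) equicontinuity radius on `K` at level `ε/3`
  obtain ⟨r₁, hr₁, hequi₁⟩ := hequi R (ε / 3) hε3
  -- (b) uniform continuity of `ρT` on a compact ball containing the `1`-neighbourhood of `K`
  obtain ⟨R₀, hKR₀⟩ := hKc.isBounded.subset_closedBall (0 : PhaseSpace N)
  set B : Set (PhaseSpace N) := closedBall (0 : PhaseSpace N) (R₀ + 1) with hB
  have hBc : IsCompact B := isCompact_closedBall _ _
  have hKB : ∀ x ∈ K, ∀ y, dist y x < 1 → y ∈ B := by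
    intro x hx y hy
    have hx0 : dist x 0 ≤ R₀ := mem_closedBall.1 (hKR₀ hx)
    exact mem_closedBall.2 (by linarith [dist_triangle y x 0])
  have huc : UniformContinuousOn ρT B := hBc.uniformContinuousOn_of_continuous hρTc.continuousOn
  obtain ⟨r₂, hr₂, huc₂⟩ := Metric.uniformContinuousOn_iff.1 huc (ε / 3) hε3
  -- the net radius
  set r : ℝ := min r₁ (min r₂ 1) with hr
  have hr0 : 0 < r := lt_min hr₁ (lt_min hr₂ one_pos)
  have hrr₁ : r ≤ r₁ := min_le_left _ _
  have hrr₂ : r ≤ r₂ := (min_le_right _ _).trans (min_le_left _ _)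
  have hr1 : r ≤ 1 := (min_le_right _ _).trans (min_le_right _ _)
  -- (c) a finite `r`-net of `K` and the pointwise limit at its points
  obtain ⟨t, htK, htf, hcover⟩ := hKc.finite_cover_balls hr0
  have hnet : ∀ᶠ δ in 𝓝[≠] (0 : ℝ), ∀ z ∈ t, |ρ δ z - ρT z| < ε / 3 := by
    rw [htf.eventually_all]
    intro z _
    have h := (Metric.tendsto_nhds.1 (hpt z)) (ε / 3) hε3
    exact h.mono fun δ hδ => by rwa [Real.dist_eq] at hδ
  -- assembly
  filter_upwards [hequi₁, hnet] with δ hδe hδn x hx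
  have hxK : x ∈ K := hx
  obtain ⟨z, hzt, hxz⟩ : ∃ z ∈ t, x ∈ ball z r := by
    have h := hcover hxK
    simpa only [mem_iUnion, exists_prop] using h
  have hzK : z ∈ K := htK hzt
  have hdxz : dist x z < r := mem_ball.1 hxz
  -- the three pieces
  have h1 : |ρ δ x - ρ δ z| ≤ ε / 3 := hδe z hzK x (mem_ball.2 (hdxz.trans_le hrr₁))
  have h2 : |ρ δ z - ρT z| < ε / 3 := hδn z hzt
  have h3 : |ρT z - ρT x| < ε / 3 := by
    have hzB : z ∈ B := hKB z hzK z (by rw [dist_self]; exact one_pos)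
    have hxB : x ∈ B := hKB z hzK x (hdxz.trans_le hr1)
    have h := huc₂ z hzB x hxB (by rw [dist_comm]; exact hdxz.trans_le hrr₂)
    rwa [Real.dist_eq] at h
  have hsum : ρ δ x - ρT x = (ρ δ x - ρ δ z) + (ρ δ z - ρT z) + (ρT z - ρT x) := by ring
  show |ρ δ x - ρT x| ≤ ε
  rw [hsum]
  calc |(ρ δ x - ρ δ z) + (ρ δ z - ρT z) + (ρT z - ρT x)|
      ≤ |ρ δ x - ρ δ z| + |ρ δ z - ρT z| + |ρT z - ρT x| := abs_add_three _ _ _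
    _ ≤ ε / 3 + ε / 3 + ε / 3 := by linarith [h1, h2.le, h3.le]
    _ = ε := by ring

/-! ## 2. The compact half of S_H1 from `δ`-uniform equicontinuity (registered helper) -/

/-- **(F_cont) from (F_equi)** (registered helper `helper_oddSandwichLocalOfEquicontinuous` for S_H1, line
`hellinger-logmean`). Along every steady-state family `μ` of the pinned chain (all parameters `> 0`), `T > 0`,
`N ≥ 1`, for a density family `ρ` (measurable, everywhere positive, representing `μ_{N,T+δ/2,T−δ/2}` eventually
in `δ ≠ 0`) that is `δ`-UNIFORMLY EQUICONTINUOUS on every energy sublevel set: for every `R` and `ε > 0`,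
eventually in `δ ≠ 0`, `|log ρ_δ(x) − log ρ_δ(Θx)| ≤ ε` for all `x` with `H(x) ≤ R`.  Uniform convergence
`ρ_δ → ρ_T` on the compact, `Θ`-invariant sublevel set (`tendstoUniformlyOn_density_of_equicontinuous`), the
positive minimum `m` of the continuous Gibbs density there, `|log a − log b| ≤ |a − b|/min a b`, and
`ρ_T∘Θ = ρ_T`. [folklore] -/
theorem helper_oddSandwichLocalOfEquicontinuous :
    ∀ ω₂ lam β γ : ℝ, 0 < ω₂ → 0 < lam → 0 < β → 0 < γ →
      ∀ μ : (N : ℕ) → ℝ → ℝ → Measure (PhaseSpace N),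
        (∀ (N : ℕ) (T_L T_R : ℝ), 0 < T_L → 0 < T_R →
          (pinnedChain ω₂ lam β γ).IsSteadyState N T_L T_R (μ N T_L T_R)) →
        ∀ T : ℝ, 0 < T → ∀ N : ℕ, 0 < N → ∀ ρ : ℝ → PhaseSpace N → ℝ,
          (∀ δ, Measurable (ρ δ)) → (∀ δ x, 0 < ρ δ x) →
          (∀ᶠ δ in 𝓝[≠] (0 : ℝ), μ N (T + δ / 2) (T - δ / 2) =
            (volume : Measure (PhaseSpace N)).withDensity (fun x => ENNReal.ofReal (ρ δ x))) →
          (∀ R ε : ℝ, 0 < ε → ∃ r : ℝ, 0 < r ∧ ∀ᶠ δ in 𝓝[≠] (0 : ℝ), ∀ x : PhaseSpace N,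
            (pinnedChain ω₂ lam β γ).hamiltonian N x ≤ R →
              ∀ y ∈ Metric.ball x r, |ρ δ y - ρ δ x| ≤ ε) →
          ∀ R ε : ℝ, 0 < ε → ∀ᶠ δ in 𝓝[≠] (0 : ℝ), ∀ x : PhaseSpace N,
            (pinnedChain ω₂ lam β γ).hamiltonian N x ≤ R →
              |Real.log (ρ δ x) - Real.log (ρ δ (x.1, -x.2))| ≤ ε := by
  intro ω₂ lam β γ hω hl hβ hγ μ hμ T hT N hN ρ hρm hρpos hρμ hequi R ε hε
  set P := pinnedChain ω₂ lam β γ with hP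
  set K : Set (PhaseSpace N) := {x | P.hamiltonian N x ≤ R} with hK
  have hKc : IsCompact K := pinnedChain_isCompact_setOf_hamiltonian_le hω hl.le hβ.le γ N R
  set Z : ℝ := ∫ y, P.gibbsDensity N T y with hZ
  have hZ0 : 0 < Z := integral_exp_pos (pinnedChain_integrable_gibbsDensity hω hl.le hβ.le γ N hT)
  set ρT : PhaseSpace N → ℝ := fun y => P.gibbsDensity N T y / Z with hρT
  have hρTc : Continuous ρT := (pinnedChain_continuous_gibbsDensity ω₂ lam β γ N T).div_const _
  have hρTpos : ∀ y, 0 < ρT y := fun y => div_pos (P.gibbsDensity_pos N T y) hZ0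
  have hρTΘ : ∀ y : PhaseSpace N, ρT (y.1, -y.2) = ρT y := fun y => by
    simp only [hρT, OscillatorChain.gibbsDensity, OscillatorChain.hamiltonian_neg_momentum]
  have hHΘ : ∀ y : PhaseSpace N, P.hamiltonian N (y.1, -y.2) = P.hamiltonian N y := fun y =>
    OscillatorChain.hamiltonian_neg_momentum P N y
  by_cases hne : K.Nonempty
  · -- the positive minimum of `ρT` on `K`
    obtain ⟨x₀, -, hmin⟩ := hKc.exists_isMinOn hne hρTc.continuousOn
    set m : ℝ := ρT x₀ with hm
    have hm0 : 0 < m := hρTpos x₀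
    have hmK : ∀ y ∈ K, m ≤ ρT y := fun y hy => hmin hy
    -- uniform convergence at level `ε' = min (m/2) (ε m / 4)`
    set ε' : ℝ := min (m / 2) (ε * m / 4) with hε'
    have hε'0 : 0 < ε' := lt_min (by positivity) (by positivity)
    have hε'm : ε' ≤ m / 2 := min_le_left _ _
    have hε'e : ε' ≤ ε * m / 4 := min_le_right _ _
    have hunif := tendstoUniformlyOn_density_of_equicontinuous hω hl hβ hγ hμ hT hN hρm hρpos hρμ hequi R ε' hε'0
    filter_upwards [hunif] with δ hδ x hx
    have hxK : x ∈ K := hx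
    have hΘK : (x.1, -x.2) ∈ K := by
      show P.hamiltonian N (x.1, -x.2) ≤ R
      rw [hHΘ x]; exact hx
    -- the log bound at a point of `K`
    have hlog : ∀ y ∈ K, |Real.log (ρ δ y) - Real.log (ρT y)| ≤ 2 * ε' / m := by
      intro y hy
      have hdy : |ρ δ y - ρT y| ≤ ε' := hδ y hy
      have hmy : m ≤ ρT y := hmK y hy
      have hlowδ : m / 2 ≤ ρ δ y := by
        have h := (abs_le.1 hdy).1
        linarith
      have hmin2 : m / 2 ≤ min (ρ δ y) (ρT y) := le_min hlowδ (by linarith)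
      have h := Literature.Topology.FourManifolds.abs_log_sub_log_le' (hρpos δ y) (hρTpos y)
      calc |Real.log (ρ δ y) - Real.log (ρT y)| ≤ |ρ δ y - ρT y| / min (ρ δ y) (ρT y) := h
        _ ≤ ε' / (m / 2) := by
            refine div_le_div₀ hε'0.le hdy (by positivity) hmin2
        _ = 2 * ε' / m := by field_simp
    have h1 := hlog x hxK
    have h2 := hlog (x.1, -x.2) hΘK
    rw [hρTΘ x] at h2
    have hsum : Real.log (ρ δ x) - Real.log (ρ δ (x.1, -x.2)) =
        (Real.log (ρ δ x) - Real.log (ρT x)) - (Real.log (ρ δ (x.1, -x.2)) - Real.log (ρT x)) := by ring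
    rw [hsum]
    have h4 : 2 * ε' / m + 2 * ε' / m ≤ ε := by
      rw [← add_div, div_le_iff₀ hm0]
      linarith
    calc |(Real.log (ρ δ x) - Real.log (ρT x)) - (Real.log (ρ δ (x.1, -x.2)) - Real.log (ρT x))|
        ≤ |Real.log (ρ δ x) - Real.log (ρT x)| + |Real.log (ρ δ (x.1, -x.2)) - Real.log (ρT x)| :=
          abs_sub _ _
      _ ≤ 2 * ε' / m + 2 * ε' / m := add_le_add h1 h2
      _ ≤ ε := h4
  · -- empty sublevel set: nothing to prove
    refine Eventually.of_forall fun δ x hx => ?_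
    exact absurd ⟨x, hx⟩ hne

end Summit.AtomisticToContinuum.FouriersLaw.Theorems.ExtensiveSnapshotIrreversibility.HellingerLogMean

end
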